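import Mathlib
import HarnessLib
import Summits.Ventures.LatticeQCDFlow.Exactness.SphereExpMapLocalChart
import Summits.Ventures.LatticeQCDFlow.Exactness.SphereExpMapMinorisation
import Summits.Ventures.LatticeQCDFlow.Exactness.SphereCapGeometry

/-!
# The projection chart of the sphere: the uniform law of a cap of radius `r < π/2` is at most `1/cos r` times Lebesgue measure on the tangent ball of radius `sin r` pushed through `v ↦ √(1 − ‖v‖²)·x + v`

HONEST FRAMING: exact (Metropolis-corrected) sampling algorithms for lattice gauge theory;
figures of merit are autocorrelation/cost numbers at stated couplings and volumes; no
continuum-physics claim.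

Venture `LatticeQCDFlow` (cell pub-lqcd), topic `Exactness`, FANOUT row 9 (eng-latcore; roadmap Step 3, route (α),
toward multi-step HMC on the `cpn_2d` sphere family, HOME/eng-latcore/HANDOFF.md GEN-19/20).  NEW WORK of the cell
over Mathlib (`lintegral_image_eq_lintegral_abs_deriv_mul`, `Real.arcsin`, `strictAntiOn_cos`, `injOn_sin`) and the
tree (row 7's `SphereAxisCoordinates` / `SphereAxisDisintegration`: `polarAxis`, `equatorEmbed`, `axisCoords`,
`latitudePt`, `lintegral_toSphere_eq_lintegral_latitude`; `RadialPolar`: `dirSphere`, `lintegral_dirSphere_norm`;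
gen-16/19's `SphereExpMapChart` / `SphereExpMapLocalChart` / `SphereCapGeometry`: `polarAxisPt`, `polarCap`,
`sphereCap`, `preimage_actSO_sphereCap`; `SphereOrbitLaw` / `SphereFrameLift`: `actSO`, `rotSO`, `exists_actSO_eq`,
`uniformSphere_map_actS`); nothing is cited as a fact; the only numbers are `1/cos r` and `sin r`.

THE POINT.  The multi-step position readout (`SphereTrajectoryReadout`, roadmap Step 2) is LINEAR in the tangent
space `T_x` — the orthogonal projection of the proposed position.  On the cap of angular radius `r < π/2` around
`x` the projection is inverted by `v ↦ √(1 − ‖v‖²)·x + v` (`v ∈ T_x`, `‖v‖ < sin r`), and in these coordinates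
the surface measure has density `1/√(1 − ‖v‖²) ≤ 1/cos r` against Lebesgue measure on `T_x`: the uniform law of
the cap is dominated by a multiple of Lebesgue measure on the small tangent ball pushed through this PROJECTION
CHART, which composes directly with the tangent-ball covering of Step 2 (no exponential map or inverse function
in between).

* §1 `projBall n y := latitudePt (arcsin ‖y‖) (y/‖y‖)` (the chart at the pole in equatorial coordinates);
  `coe_projBall` (`= √(1 − ‖y‖²)·e₀ + (0, y)`, `‖y‖ ≤ 1`), **`axisCoords_projBall`** (its tangent coordinate is
  `y`), **`projBall_axisCoords_snd`** (every point with `⟪e₀, x⟫ ≥ 0` lies above its tangent coordinate),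
  **`projBall_mem_polarCap_iff`** (`0 ≤ r ≤ π/2`: in the cap iff `‖y‖ < sin r`).
* §2 `setLIntegral_sin_pow_le_arcsin`: `∫_{(0,r)} g θ sin^n θ dθ ≤ (1/cos r) ∫_{(0,sin r)} g(arcsin u) u^n du`.
* §3 **`lintegral_polarCap_le_projBall`** (`0 < r < π/2`): `∫_{polarCap r} G dσ ≤ (1/cos r) ∫_{‖y‖<sin r} G(projBall y) dy`;
  **`toSphere_restrict_polarCap_le_projBall`**: `σ|_{polarCap r} ≤ (1/cos r) • (Leb|_{ball 0 (sin r)}).map projBall`.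
* §4 `polarCap_eq_sphereCap`, `projChartConst n r = |S^{n+1}|⁻¹/cos r` (`≠ 0`, `≠ ⊤`), and from EVERY centre
  **`uniformSphere_restrict_sphereCap_le`**: `∃ O ∈ SO(n+2)`, `O e₀ = x`,
  `uniformSphere|_{cap(x,r)} ≤ projChartConst n r • (Leb|_{ball 0 (sin r)}).map (y ↦ O(projBall y))`, where
  `O(projBall y) = √(1 − ‖y‖²)·x + O(0,y)` with `O(0,·)` a linear isometry `ℝ^{n+1} → T_x` (`coe_actSO_projBall`,
  `inner_actSO_polarAxisPt_rotSO_equatorEmbed`, `norm_rotSO_equatorEmbed`).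

NOT CLAIMED: equality / the exact Jacobian; anything for `r ≥ π/2`; the composition with the trajectory
readout and the momentum law (roadmap Step 4), cap chaining (Step 5), families, constants beyond the two
displayed.
-/

noncomputable section

namespace Summit.Ventures.LatticeQCDFlow.Exactness

open MeasureTheory Measure Metric Set Real InnerProductGeometry
open scoped ENNReal InnerProductSpace

/-! ## §1 The projection chart at the pole -/

section Chart

variable (n : ℕ)

/-- **The projection chart at the pole**: the point of the upper hemisphere of `S^{n+1}` above the tangent
(equatorial) vector `y`, `√(1 − ‖y‖²)·e₀ + (0, y)` for `‖y‖ ≤ 1`, written through the latitude map as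
`latitudePt (arcsin ‖y‖) (y/‖y‖)` (defined for every `y`; only `‖y‖ ≤ 1` is ever used). -/
def projBall (y : EuclideanSpace ℝ (Fin (n + 1))) : sphere (0 : EuclideanSpace ℝ (Fin (n + 2))) 1 :=
  latitudePt n (arcsin ‖y‖) (dirSphere y)

/-- `projBall n` is measurable. -/
theorem measurable_projBall : Measurable (projBall n) := by
  have h : projBall n =
      (fun p : ℝ × sphere (0 : EuclideanSpace ℝ (Fin (n + 1))) 1 => latitudePt n p.1 p.2) ∘
        fun y => (arcsin ‖y‖, dirSphere y) := rfl
  rw [h]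
  exact (measurable_latitudePt n).comp
    ((measurable_arcsin.comp measurable_norm).prodMk measurable_dirSphere)

/-- `⟪e₀, projBall y⟫ = √(1 − ‖y‖²)`. -/
theorem inner_polarAxis_projBall (y : EuclideanSpace ℝ (Fin (n + 1))) :
    ⟪polarAxis n, (projBall n y : EuclideanSpace ℝ (Fin (n + 2)))⟫_ℝ = √(1 - ‖y‖ ^ 2) := by
  rw [projBall, inner_polarAxis_latitudePt, cos_arcsin]

/-- **Vector form** (`‖y‖ ≤ 1`): `projBall y = √(1 − ‖y‖²) • e₀ + (0, y)`. -/
theorem coe_projBall {y : EuclideanSpace ℝ (Fin (n + 1))} (hy : ‖y‖ ≤ 1) :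
    (projBall n y : EuclideanSpace ℝ (Fin (n + 2))) = √(1 - ‖y‖ ^ 2) • polarAxis n + equatorEmbed n y := by
  rw [projBall, coe_latitudePt, cos_arcsin, sin_arcsin (by linarith [norm_nonneg y]) hy]
  congr 1
  by_cases h0 : y = 0
  · subst h0; simp
  · rw [dirSphere_coe h0, map_smul, smul_smul, mul_inv_cancel₀ (norm_ne_zero_iff.2 h0), one_smul]

/-- **The tangent coordinate of `projBall y` is `y`** (and its axis coordinate is `√(1 − ‖y‖²)`), `‖y‖ ≤ 1`:
`projBall` is a right inverse of the orthogonal projection onto the equatorial hyperplane. -/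
theorem axisCoords_projBall {y : EuclideanSpace ℝ (Fin (n + 1))} (hy : ‖y‖ ≤ 1) :
    axisCoords n (projBall n y : EuclideanSpace ℝ (Fin (n + 2))) = (√(1 - ‖y‖ ^ 2), y) := by
  rw [coe_projBall n hy, ← axisCoords_symm_apply_eq, MeasurableEquiv.apply_symm_apply]

/-- **Every point of the closed upper hemisphere lies above its tangent coordinate**:
`projBall (axisCoords x).2 = x` whenever `0 ≤ ⟪e₀, x⟫`. -/
theorem projBall_axisCoords_snd {x : sphere (0 : EuclideanSpace ℝ (Fin (n + 2))) 1}
    (hx : 0 ≤ ⟪polarAxis n, (x : EuclideanSpace ℝ (Fin (n + 2)))⟫_ℝ) :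
    projBall n (axisCoords n (x : EuclideanSpace ℝ (Fin (n + 2)))).2 = x := by
  set t : ℝ := (axisCoords n (x : EuclideanSpace ℝ (Fin (n + 2)))).1 with ht_def
  set y : EuclideanSpace ℝ (Fin (n + 1)) := (axisCoords n (x : EuclideanSpace ℝ (Fin (n + 2)))).2 with hy_def
  have hxe : (x : EuclideanSpace ℝ (Fin (n + 2))) = (axisCoords n).symm (t, y) := by
    rw [ht_def, hy_def, Prod.mk.eta, MeasurableEquiv.symm_apply_apply]
  have h1 : t ^ 2 + ‖y‖ ^ 2 = 1 := by
    rw [← norm_sq_axisCoords_symm, ← hxe, norm_eq_of_mem_sphere, one_pow]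
  have ht0 : 0 ≤ t := by rwa [ht_def, ← inner_polarAxis_eq_fst]
  have hy1 : ‖y‖ ≤ 1 := by nlinarith [sq_nonneg t, norm_nonneg y]
  have ht : √(1 - ‖y‖ ^ 2) = t := by
    rw [show 1 - ‖y‖ ^ 2 = t ^ 2 by linarith, Real.sqrt_sq ht0]
  apply Subtype.ext
  rw [coe_projBall n hy1, hxe, axisCoords_symm_apply_eq, ht]

/-- **A tangent vector of length `≤ 1` lands in the polar cap of radius `r ∈ [0, π/2]` iff its length is
`< sin r`.** -/
theorem projBall_mem_polarCap_iff {r : ℝ} (hr0 : 0 ≤ r) (hr : r ≤ π / 2)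
    {y : EuclideanSpace ℝ (Fin (n + 1))} (hy : ‖y‖ ≤ 1) :
    projBall n y ∈ polarCap n r ↔ ‖y‖ < sin r := by
  rw [mem_polarCap, projBall, inner_polarAxis_latitudePt]
  have ha0 : 0 ≤ arcsin ‖y‖ := arcsin_nonneg.2 (norm_nonneg _)
  have haπ : arcsin ‖y‖ ≤ π / 2 := arcsin_le_pi_div_two _
  rw [strictAntiOn_cos.lt_iff_gt ⟨hr0, by linarith [pi_pos]⟩ ⟨ha0, by linarith [pi_pos]⟩]
  exact arcsin_lt_iff_lt_sin ⟨by linarith [norm_nonneg y], hy⟩ ⟨by linarith [pi_pos], hr⟩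

end Chart

/-! ## §2 The radial substitution `u = sin θ` -/

section Radial

variable (n : ℕ)

/-- **The radial comparison by the substitution `u = sin θ`.**  For `g ≥ 0` and `0 < r < π/2`:
`∫_{(0,r)} g θ · sin^n θ dθ ≤ (1/cos r) · ∫_{(0, sin r)} g(arcsin u) · u^n du`
(insert `1 ≤ cos θ / cos r` on `(0, r)`, then change variables `u = sin θ`, `du = cos θ dθ`, and enlarge
`sin '' (0, r) ⊆ (0, sin r)`). -/
theorem setLIntegral_sin_pow_le_arcsin {r : ℝ} (hr0 : 0 < r) (hr : r < π / 2) (g : ℝ → ℝ≥0∞) :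
    ∫⁻ θ in Ioo 0 r, g θ * ENNReal.ofReal (sin θ ^ n) ≤
      ENNReal.ofReal (1 / cos r) * ∫⁻ u in Ioo 0 (sin r), g (arcsin u) * ENNReal.ofReal (u ^ n) := by
  have hcr : 0 < cos r := cos_pos_of_mem_Ioo ⟨by linarith, hr⟩
  -- (1) pointwise on `(0, r)`: insert the Jacobian, `1 ≤ cos θ / cos r`
  have h1 : ∫⁻ θ in Ioo 0 r, g θ * ENNReal.ofReal (sin θ ^ n) ≤
      ∫⁻ θ in Ioo 0 r, ENNReal.ofReal (1 / cos r) *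
        (ENNReal.ofReal |cos θ| * (g (arcsin (sin θ)) * ENNReal.ofReal (sin θ ^ n))) := by
    refine setLIntegral_mono' measurableSet_Ioo fun θ hθ => ?_
    have hθ1 : -(π / 2) ≤ θ := by linarith [hθ.1, pi_pos]
    have hθ2 : θ ≤ π / 2 := by linarith [hθ.2]
    have hcθ : cos r ≤ cos θ := cos_le_cos_of_nonneg_of_le_pi hθ.1.le (by linarith) hθ.2.le
    rw [arcsin_sin hθ1 hθ2, abs_of_pos (hcr.trans_le hcθ), ← mul_assoc, ← ENNReal.ofReal_mul (by positivity)]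
    have hone : (1 : ℝ≥0∞) ≤ ENNReal.ofReal (1 / cos r * cos θ) := by
      rw [← ENNReal.ofReal_one]
      refine ENNReal.ofReal_le_ofReal ?_
      rwa [one_div, inv_mul_eq_div, le_div_iff₀ hcr, one_mul]
    calc g θ * ENNReal.ofReal (sin θ ^ n) = 1 * (g θ * ENNReal.ofReal (sin θ ^ n)) := (one_mul _).symm
      _ ≤ ENNReal.ofReal (1 / cos r * cos θ) * (g θ * ENNReal.ofReal (sin θ ^ n)) := by gcongr
  refine h1.trans ?_
  rw [lintegral_const_mul' _ _ ENNReal.ofReal_ne_top]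
  refine mul_le_mul_of_nonneg_left ?_ zero_le
  -- (2) change of variables `u = sin θ` on `(0, r)`
  have hderiv : ∀ θ ∈ Ioo 0 r, HasDerivWithinAt sin (cos θ) (Ioo 0 r) θ := fun θ _ => (hasDerivAt_sin θ).hasDerivWithinAt
  have hsub : Ioo 0 r ⊆ Icc (-(π / 2)) (π / 2) := fun θ hθ => ⟨by linarith [hθ.1, pi_pos], by linarith [hθ.2]⟩
  have hinj : InjOn sin (Ioo 0 r) := injOn_sin.mono hsub
  rw [← lintegral_image_eq_lintegral_abs_deriv_mul measurableSet_Ioo hderiv hinj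
    (fun u => g (arcsin u) * ENNReal.ofReal (u ^ n))]
  -- (3) `sin '' (0, r) ⊆ (0, sin r)`
  refine lintegral_mono_set ?_
  rintro _ ⟨θ, hθ, rfl⟩
  have hrI : r ∈ Icc (-(π / 2)) (π / 2) := ⟨by linarith [pi_pos], hr.le⟩
  exact ⟨sin_pos_of_pos_of_lt_pi hθ.1 (by linarith [hθ.2, pi_pos]), strictMonoOn_sin (hsub hθ) hrI hθ.2⟩

end Radial

/-! ## §3 The projection-chart comparison at the pole -/

section Pole

variable (n : ℕ)

/-- **THE PROJECTION-CHART COMPARISON (integral form).**  For `0 < r < π/2` and measurable `G ≥ 0` on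
`S^{n+1}`: `∫_{polarCap r} G dσ_{n+2} ≤ (1/cos r) · ∫_{‖y‖ < sin r} G(projBall y) dy` — the surface measure of
the polar cap is dominated by `1/cos r` times Lebesgue measure on the tangent ball of radius `sin r` pushed
through the projection chart.  (Latitude disintegration on the round side, polar coordinates on the flat side,
the substitution `u = sin θ` with Jacobian `cos θ ≥ cos r` in between.) -/
theorem lintegral_polarCap_le_projBall {r : ℝ} (hr0 : 0 < r) (hr : r < π / 2)
    {G : sphere (0 : EuclideanSpace ℝ (Fin (n + 2))) 1 → ℝ≥0∞} (hG : Measurable G) :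
    ∫⁻ x in polarCap n r, G x ∂(volume : Measure (EuclideanSpace ℝ (Fin (n + 2)))).toSphere ≤
      ENNReal.ofReal (1 / cos r) *
        ∫⁻ y in ball (0 : EuclideanSpace ℝ (Fin (n + 1))) (sin r), G (projBall n y) ∂volume := by
  have hcap := measurableSet_polarCap n r
  have hrπ : r < π := hr.trans (by linarith [pi_pos])
  -- the round side: indicator, latitude coordinates, and on `(0, π)` the cap is `θ < r`
  rw [← lintegral_indicator hcap, lintegral_toSphere_eq_lintegral_latitude n (hG.indicator hcap)]
  have hround : ∀ w : sphere (0 : EuclideanSpace ℝ (Fin (n + 1))) 1,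
      ∫⁻ θ in Ioo 0 π, (polarCap n r).indicator G (latitudePt n θ w) * ENNReal.ofReal (sin θ ^ n) =
        ∫⁻ θ in Ioo 0 r, G (latitudePt n θ w) * ENNReal.ofReal (sin θ ^ n) := by
    intro w
    rw [← lintegral_indicator measurableSet_Ioo, ← lintegral_indicator measurableSet_Ioo]
    refine lintegral_congr fun θ => ?_
    by_cases hθr : θ ∈ Ioo 0 r
    · have hθπ : θ ∈ Ioo 0 π := ⟨hθr.1, hθr.2.trans hrπ⟩
      have hmem : latitudePt n θ w ∈ polarCap n r := by
        rw [mem_polarCap, inner_polarAxis_latitudePt]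
        exact cos_lt_cos_of_nonneg_of_le_pi hθr.1.le hrπ.le hθr.2
      rw [indicator_of_mem hθπ, indicator_of_mem hθr, indicator_of_mem hmem]
    · rw [indicator_of_notMem hθr]
      by_cases hθπ : θ ∈ Ioo 0 π
      · have hrθ : r ≤ θ := by
          by_contra h
          exact hθr ⟨hθπ.1, not_le.1 h⟩
        have hnot : latitudePt n θ w ∉ polarCap n r := by
          rw [mem_polarCap, inner_polarAxis_latitudePt, not_lt]
          exact cos_le_cos_of_nonneg_of_le_pi hr0.le hθπ.2.le hrθ
        rw [indicator_of_mem hθπ, indicator_of_notMem hnot, zero_mul]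
      · rw [indicator_of_notMem hθπ]
  simp_rw [hround]
  -- the flat side in polar coordinates: the integrand as a function of (direction, radius)
  set F : sphere (0 : EuclideanSpace ℝ (Fin (n + 1))) 1 × ℝ → ℝ≥0∞ :=
    (Prod.snd ⁻¹' Iio (sin r)).indicator fun p => G (latitudePt n (arcsin p.2) p.1) with hF_def
  have hF : Measurable F :=
    (hG.comp ((measurable_latitudePt n).comp
      ((measurable_arcsin.comp measurable_snd).prodMk measurable_fst))).indicator
      (measurable_snd measurableSet_Iio)
  have hflat : ∫⁻ y in ball (0 : EuclideanSpace ℝ (Fin (n + 1))) (sin r), G (projBall n y) ∂volume =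
      ∫⁻ y, F (dirSphere y, ‖y‖) ∂volume := by
    rw [← lintegral_indicator measurableSet_ball]
    refine lintegral_congr fun y => ?_
    by_cases hy : y ∈ ball (0 : EuclideanSpace ℝ (Fin (n + 1))) (sin r)
    · have hy' : ((dirSphere y, ‖y‖) : sphere (0 : EuclideanSpace ℝ (Fin (n + 1))) 1 × ℝ) ∈
          Prod.snd ⁻¹' Iio (sin r) := by simpa using hy
      rw [indicator_of_mem hy, hF_def, indicator_of_mem hy']
      rfl
    · have hy' : ((dirSphere y, ‖y‖) : sphere (0 : EuclideanSpace ℝ (Fin (n + 1))) 1 × ℝ) ∉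
          Prod.snd ⁻¹' Iio (sin r) := by simpa using hy
      rw [indicator_of_notMem hy, hF_def, indicator_of_notMem hy']
  have hF2 : Measurable fun p : sphere (0 : EuclideanSpace ℝ (Fin (n + 1))) 1 × Ioi (0 : ℝ) =>
      F (p.1, (p.2 : ℝ)) :=
    hF.comp (measurable_fst.prodMk (measurable_subtype_coe.comp measurable_snd))
  rw [hflat, lintegral_dirSphere_norm volume hF, finrank_euclideanSpace_fin,
    show n + 1 - 1 = n by omega,
    lintegral_prod (fun p : sphere (0 : EuclideanSpace ℝ (Fin (n + 1))) 1 × Ioi (0 : ℝ) =>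
      F (p.1, (p.2 : ℝ))) hF2.aemeasurable]
  -- the inner radial integral against `u^n du` on `(0, ∞)`
  have hinner : ∀ s : sphere (0 : EuclideanSpace ℝ (Fin (n + 1))) 1,
      ∫⁻ u, F (s, (u : ℝ)) ∂(Measure.volumeIoiPow n) =
        ∫⁻ u in Ioo 0 (sin r), G (latitudePt n (arcsin u) s) * ENNReal.ofReal (u ^ n) := by
    intro s
    have hFs : Measurable fun u : ℝ => F (s, u) := hF.comp (measurable_const.prodMk measurable_id)
    have hFs' : Measurable fun u : Ioi (0 : ℝ) => F (s, (u : ℝ)) := hFs.comp measurable_subtype_coe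
    rw [Measure.volumeIoiPow, lintegral_withDensity_eq_lintegral_mul _
      ((measurable_subtype_coe.pow_const n).ennreal_ofReal) hFs']
    have hsub := lintegral_subtype_comap (μ := (volume : Measure ℝ)) (measurableSet_Ioi (a := (0 : ℝ)))
      (fun u : ℝ => ENNReal.ofReal (u ^ n) * F (s, u))
    refine (Eq.trans (lintegral_congr fun u => rfl) hsub).trans ?_
    rw [← lintegral_indicator measurableSet_Ioi, ← lintegral_indicator measurableSet_Ioo]
    refine lintegral_congr fun u => ?_
    by_cases h0 : 0 < u
    · by_cases h1 : u < sin r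
      · have hu : ((s, u) : sphere (0 : EuclideanSpace ℝ (Fin (n + 1))) 1 × ℝ) ∈ Prod.snd ⁻¹' Iio (sin r) := h1
        rw [indicator_of_mem (show u ∈ Ioi (0 : ℝ) from h0),
          indicator_of_mem (show u ∈ Ioo 0 (sin r) from ⟨h0, h1⟩), hF_def, indicator_of_mem hu, mul_comm]
      · have hu : ((s, u) : sphere (0 : EuclideanSpace ℝ (Fin (n + 1))) 1 × ℝ) ∉ Prod.snd ⁻¹' Iio (sin r) := h1
        rw [indicator_of_mem (show u ∈ Ioi (0 : ℝ) from h0),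
          indicator_of_notMem (show u ∉ Ioo 0 (sin r) from fun h => h1 h.2), hF_def,
          indicator_of_notMem hu, mul_zero]
    · rw [indicator_of_notMem (show u ∉ Ioi (0 : ℝ) from h0),
        indicator_of_notMem (show u ∉ Ioo 0 (sin r) from fun h => h0 h.1)]
  simp_rw [hinner]
  -- compare the inner integrals and pull the constant out
  rw [← lintegral_const_mul' _ _ ENNReal.ofReal_ne_top]
  refine lintegral_mono fun s => ?_
  exact setLIntegral_sin_pow_le_arcsin n hr0 hr fun θ => G (latitudePt n θ s)

/-- **THE PROJECTION-CHART COMPARISON (measure form)**, `0 < r < π/2`: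
`σ_{n+2}|_{polarCap r} ≤ (1/cos r) • (Lebesgue|_{ball 0 (sin r)}).map (projBall n)`. -/
theorem toSphere_restrict_polarCap_le_projBall {r : ℝ} (hr0 : 0 < r) (hr : r < π / 2) :
    (volume : Measure (EuclideanSpace ℝ (Fin (n + 2)))).toSphere.restrict (polarCap n r) ≤
      ENNReal.ofReal (1 / cos r) •
        ((volume : Measure (EuclideanSpace ℝ (Fin (n + 1)))).restrict (ball 0 (sin r))).map (projBall n) := by
  refine Measure.le_iff.2 fun A hA => ?_
  have hind : Measurable (A.indicator (1 : sphere (0 : EuclideanSpace ℝ (Fin (n + 2))) 1 → ℝ≥0∞)) :=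
    measurable_one.indicator hA
  rw [← lintegral_indicator_one hA, Measure.smul_apply, smul_eq_mul,
    Measure.map_apply (measurable_projBall n) hA, ← lintegral_indicator_one ((measurable_projBall n) hA)]
  refine (lintegral_polarCap_le_projBall n hr0 hr hind).trans (le_of_eq ?_)
  congr 1

end Pole

/-! ## §4 From every centre, by rotation -/

section Centre

variable (n : ℕ)

/-- **The polar cap is the cap of `SphereCapGeometry` around the pole** (`0 ≤ r ≤ π`):
`cos r < ⟪e₀, x⟫ ↔ angle e₀ x < r`. -/
theorem polarCap_eq_sphereCap {r : ℝ} (hr0 : 0 ≤ r) (hr : r ≤ π) :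
    polarCap n r = sphereCap (polarAxisPt n) r := by
  ext x
  rw [mem_polarCap, mem_sphereCap, coe_polarAxisPt]
  have hcs : cos (angle (polarAxis n) (x : EuclideanSpace ℝ (Fin (n + 2)))) =
      ⟪polarAxis n, (x : EuclideanSpace ℝ (Fin (n + 2)))⟫_ℝ := by
    rw [cos_angle, norm_polarAxis, norm_eq_of_mem_sphere, one_mul, div_one]
  rw [← hcs]
  exact strictAntiOn_cos.lt_iff_gt ⟨hr0, hr⟩ ⟨angle_nonneg _ _, angle_le_pi _ _⟩

/-- **The constant of the projection chart**: `|S^{n+1}|⁻¹ · (1/cos r)` (the uniform probability is the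
surface measure divided by its mass). -/
def projChartConst (r : ℝ) : ℝ≥0∞ :=
  ((volume : Measure (EuclideanSpace ℝ (Fin (n + 2)))).toSphere univ)⁻¹ * ENNReal.ofReal (1 / cos r)

/-- The constant is not zero (`r < π/2`, any `r` with `cos r > 0`). -/
theorem projChartConst_ne_zero {r : ℝ} (hr0 : -(π / 2) < r) (hr : r < π / 2) : projChartConst n r ≠ 0 := by
  have hcr : 0 < cos r := cos_pos_of_mem_Ioo ⟨hr0, hr⟩
  exact mul_ne_zero (ENNReal.inv_ne_zero.2 (measure_ne_top _ _))
    (ENNReal.ofReal_pos.2 (by positivity)).ne'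

/-- The constant is finite. -/
theorem projChartConst_ne_top (r : ℝ) : projChartConst n r ≠ ⊤ :=
  ENNReal.mul_ne_top (ENNReal.inv_ne_top.2 (toSphere_univ_ne_zero _)) ENNReal.ofReal_ne_top

/-- The rotated chart in coordinates: `O (projBall y) = √(1 − ‖y‖²) • (O e₀) + O (0, y)` (`‖y‖ ≤ 1`). -/
theorem coe_actSO_projBall (O : Matrix.specialOrthogonalGroup (Fin (n + 2)) ℝ)
    {y : EuclideanSpace ℝ (Fin (n + 1))} (hy : ‖y‖ ≤ 1) :
    (actSO O (projBall n y) : EuclideanSpace ℝ (Fin (n + 2))) =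
      √(1 - ‖y‖ ^ 2) • (actSO O (polarAxisPt n) : EuclideanSpace ℝ (Fin (n + 2))) +
        rotSO O (equatorEmbed n y) := by
  rw [coe_actSO_eq_rotSO, coe_projBall n hy, map_add, map_smul, coe_actSO_eq_rotSO, coe_polarAxisPt]

/-- The rotated equator is the tangent space at the rotated pole: `⟪O e₀, O (0, y)⟫ = 0`. -/
theorem inner_actSO_polarAxisPt_rotSO_equatorEmbed (O : Matrix.specialOrthogonalGroup (Fin (n + 2)) ℝ)
    (y : EuclideanSpace ℝ (Fin (n + 1))) :
    ⟪(actSO O (polarAxisPt n) : EuclideanSpace ℝ (Fin (n + 2))), rotSO O (equatorEmbed n y)⟫_ℝ = 0 := by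
  rw [coe_actSO_eq_rotSO, coe_polarAxisPt, LinearIsometryEquiv.inner_map_map, inner_polarAxis_equatorEmbed]

/-- `y ↦ O (0, y)` is a linear isometry: `‖O (0, y)‖ = ‖y‖`. -/
theorem norm_rotSO_equatorEmbed (O : Matrix.specialOrthogonalGroup (Fin (n + 2)) ℝ)
    (y : EuclideanSpace ℝ (Fin (n + 1))) : ‖rotSO O (equatorEmbed n y)‖ = ‖y‖ := by
  rw [LinearIsometryEquiv.norm_map, norm_equatorEmbed]

/-- **THE PROJECTION CHART DOMINATES THE UNIFORM LAW OF A CAP, FROM EVERY CENTRE.**  For `0 < r < π/2` and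
every `x ∈ S^{n+1}` there is a rotation `O ∈ SO(n+2)` with `O e₀ = x` such that
`uniformSphere|_{cap(x, r)} ≤ projChartConst n r • (Lebesgue|_{ball 0 (sin r)}).map (y ↦ O (projBall y))` —
the uniform probability restricted to the cap of angular radius `r` around `x` is dominated by a multiple of
Lebesgue measure on the ball of radius `sin r` of `ℝ^{n+1} ≅ T_x` (through `y ↦ O(0, y)`) pushed through the
chart `v ↦ √(1 − ‖v‖²) x + v`.  (`SO(n+2)` is transitive; caps, the uniform law and the chart are equivariant.) -/
theorem uniformSphere_restrict_sphereCap_le (x : sphere (0 : EuclideanSpace ℝ (Fin (n + 2))) 1)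
    {r : ℝ} (hr0 : 0 < r) (hr : r < π / 2) :
    ∃ O : Matrix.specialOrthogonalGroup (Fin (n + 2)) ℝ, actSO O (polarAxisPt n) = x ∧
      (uniformSphere (volume : Measure (EuclideanSpace ℝ (Fin (n + 2))))).restrict (sphereCap x r) ≤
        projChartConst n r •
          (((volume : Measure (EuclideanSpace ℝ (Fin (n + 1)))).restrict (ball 0 (sin r))).map
            fun y => actSO O (projBall n y)) := by
  obtain ⟨O, hO⟩ := exists_actSO_eq (by rw [Fintype.card_fin]; omega) (polarAxisPt n) x
  refine ⟨O, hO, ?_⟩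
  have hA : Measurable (actSO O : sphere (0 : EuclideanSpace ℝ (Fin (n + 2))) 1 →
      sphere (0 : EuclideanSpace ℝ (Fin (n + 2))) 1) := measurable_actSO_right O
  -- the uniform law and the caps are invariant under the rotation
  have hσ : (uniformSphere (volume : Measure (EuclideanSpace ℝ (Fin (n + 2))))).map (actSO O) =
      uniformSphere (volume : Measure (EuclideanSpace ℝ (Fin (n + 2)))) :=
    uniformSphere_map_actS (mem_orthogonalGroup_of_SO O)
  have hpre : actSO O ⁻¹' sphereCap x r = polarCap n r := by
    rw [← hO, preimage_actSO_sphereCap, polarCap_eq_sphereCap n hr0.le (hr.le.trans (by linarith [pi_pos]))]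
  have hrestr : (uniformSphere (volume : Measure (EuclideanSpace ℝ (Fin (n + 2))))).restrict (sphereCap x r) =
      ((uniformSphere (volume : Measure (EuclideanSpace ℝ (Fin (n + 2))))).restrict (polarCap n r)).map
        (actSO O) := by
    rw [← hpre, ← Measure.restrict_map hA (measurableSet_sphereCap x r), hσ]
  -- the pole estimate for the surface measure, normalised and rotated
  have hpole := toSphere_restrict_polarCap_le_projBall n hr0 hr
  have hunif : (uniformSphere (volume : Measure (EuclideanSpace ℝ (Fin (n + 2))))).restrict (polarCap n r) =
      ((volume : Measure (EuclideanSpace ℝ (Fin (n + 2)))).toSphere univ)⁻¹ •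
        (volume : Measure (EuclideanSpace ℝ (Fin (n + 2)))).toSphere.restrict (polarCap n r) := by
    rw [uniformSphere, Measure.restrict_smul]
  have hle : (uniformSphere (volume : Measure (EuclideanSpace ℝ (Fin (n + 2))))).restrict (polarCap n r) ≤
      projChartConst n r •
        ((volume : Measure (EuclideanSpace ℝ (Fin (n + 1)))).restrict (ball 0 (sin r))).map (projBall n) := by
    rw [hunif, projChartConst, ← smul_smul]
    refine Measure.le_iff.2 fun A _ => ?_
    have h := Measure.le_iff'.1 hpole A
    simp only [Measure.smul_apply, smul_eq_mul] at h ⊢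
    exact mul_le_mul_of_nonneg_left h zero_le
  calc (uniformSphere (volume : Measure (EuclideanSpace ℝ (Fin (n + 2))))).restrict (sphereCap x r)
      = ((uniformSphere (volume : Measure (EuclideanSpace ℝ (Fin (n + 2))))).restrict (polarCap n r)).map
          (actSO O) := hrestr
    _ ≤ (projChartConst n r •
          ((volume : Measure (EuclideanSpace ℝ (Fin (n + 1)))).restrict (ball 0 (sin r))).map (projBall n)).map
          (actSO O) := Measure.map_mono hle hA
    _ = projChartConst n r •
          (((volume : Measure (EuclideanSpace ℝ (Fin (n + 1)))).restrict (ball 0 (sin r))).map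
            fun y => actSO O (projBall n y)) := by
        rw [Measure.map_smul, Measure.map_map hA (measurable_projBall n)]
        rfl

end Centre

end Summit.Ventures.LatticeQCDFlow.Exactness

end
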